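import Summits.Parity.GeneralizedHardyLittlewood.Theorems.PrimeLevelFamEdgeMomentsBeyondDiagonalDiagRemTwoTwoColumns
import Summits.Parity.GeneralizedHardyLittlewood.Theorems.PrimeLevelFamEdgeMomentsBeyondDiagonalDiagRemTwoTwoBoseA
import HarnessLib

/-!
# Route `PrimeLevelFamEdge`, crux K_A `MomentsBeyondDiagonal` (stmt-Parity-20007), line «petersson_layers» v4, stub `stub_diag`:
# **the nine remainder kernels of order `(2,2)` under ONE set of constants, and the envelope arithmetic of (R₂₂)** (brick B4b)

Brick B4b of (R₂₂) — the hypothesis `hR₂₂` of `…DiagRungTwoOfR22.diagPart_asymp_of_natDegree_le_two_of_remainder` (p830190).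
Bookkeeping only: the two-sequence Abel estimates of `…DiagRemTwoTwoBoseA` (`r₀₁,r₀₂,r₁₀,r₁₁`), `…DiagRemTwoTwoBoseB`
(`r₁₂,r₂₀,r₂₁,r₂₂`) and `…DiagRemTwoTwoColumns` (`r₀₀` + the both-sided monomial) are put under ONE envelope constant `C₀`
(the envelopes are monotone in `C₀`), in the disjunctive form consumed by `…DiagRemTwoTwoMonomials.abs_profile_weight_le₂₂`; and
the purely real inequality collecting the four envelopes of the inner estimate into `KK·D²·Λ¹²·(√(2αK₁Y) + (1+log K₁)⁻¹²)` is
isolated (`envelope_arith₂₂`), monomial by monomial (`ly ≤ Λ`, `x ≤ 2Λ`, `1 ≤ D ≤ D²`, `Λ^k ≤ Λ¹²`).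

* `twoSeq_envelope_mono` — monotonicity of the two-sequence envelope in `C₀`;
* `twoSeq_nine₂₂` — **`∃ E₀₀ … E₂₂ C₀ C_P ≥ 0`: the nine two-sequence estimates (common `C₀`, moments
  `μ₂ = ∫₀¹log²v·v/(1+v²)²`, `μ₄ = ∫₀¹log⁴v·v/(1+v²)²` explicit) and the budget-sharp both-sided bound;**
* `envelope_arith₂₂` — the closing real inequality of the inner estimate.

Def-free; theorems only. Helper `--supports stmt-Parity-20007`; closes nothing; K_A, K_B and the Parity summit are NOT proved;
nothing about Landau–Siegel zeros.

## References
* E. Kowalski, P. Michel, J. VanderKam, J. reine angew. Math. 526 (2000), (22)–(28) pp. 12–15 and Prop. 5.1 p. 18.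
  [cite: KowalskiMichelVanderKam2000, (23)–(28) and Prop. 5.1 — derivation (order-(2,2) remainder, inner sums)]
-/

noncomputable section

open scoped Real
open Finset Real MeasureTheory

namespace Summit.Parity.GeneralizedHardyLittlewood.Theorems.MomentsBeyondDiagonal.DiagCorner

open Summit.Parity.GeneralizedHardyLittlewood.Theorems.BeyondDiagonalBeatsQuarter.KernelFormXSq
  (copTauW divWeight divWeight_nonneg)
open Summit.Parity.GeneralizedHardyLittlewood.Theorems.BeyondDiagonalBeatsQuarter.Corner

/-- Monotonicity of the two-sequence envelope in the constant `C₀`. [folklore] -/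
theorem twoSeq_envelope_mono {S₁ S₂ B η Li Lj s x C' C v : ℝ} (hS₁ : 0 ≤ S₁) (hS₂ : 0 ≤ S₂) (hB : 0 ≤ B) (hη : 0 ≤ η)
    (hLi : 0 ≤ Li) (hLj : 0 ≤ Lj) (hs : 0 ≤ s) (hx : 0 ≤ x) (hC : C' ≤ C)
    (hv : v ≤ S₁ * (B * (Lj * (3 * C' * s))) + S₂ * ((2 * η) * (Li * (9 * C' * x ^ 6)))) :
    v ≤ S₁ * (B * (Lj * (3 * C * s))) + S₂ * ((2 * η) * (Li * (9 * C * x ^ 6))) := by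
  have hx6 : 0 ≤ x ^ 6 := pow_nonneg hx 6
  have e1 : 3 * C' * s ≤ 3 * C * s := by nlinarith
  have e2 : 9 * C' * x ^ 6 ≤ 9 * C * x ^ 6 := by nlinarith
  refine hv.trans (add_le_add ?_ ?_)
  · exact mul_le_mul_of_nonneg_left (mul_le_mul_of_nonneg_left (mul_le_mul_of_nonneg_left e1 hLj) hB) hS₁
  · exact mul_le_mul_of_nonneg_left (mul_le_mul_of_nonneg_left (mul_le_mul_of_nonneg_left e2 hLi)
      (by positivity)) hS₂

set_option maxHeartbeats 1600000 in
-- nine kernels, large statement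
/-- **The nine remainder kernels of order `(2,2)` under one set of constants, plus the both-sided monomial** (module docstring).
[cite: KowalskiMichelVanderKam2000, (23)–(28) and Prop. 5.1 — derivation (order-(2,2) remainder, inner sums)] -/
theorem twoSeq_nine₂₂ : ∃ E₀₀ E₀₁ E₁₀ E₀₂ E₂₀ E₁₁ E₁₂ E₂₁ E₂₂ C₀ C_P : ℝ, 0 ≤ C₀ ∧ 0 ≤ C_P ∧
    (∀ R : ℝ → ℝ,
      (R = (fun y : ℝ ↦ (∫ u₁ in Set.Ioi (0 : ℝ), ∫ u₂ in Set.Ioi (y / u₁),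
              Real.exp (-(u₁ + u₂)) / (1 - Real.exp (-(u₁ + u₂))) ^ 2) -
            (Real.log (1 / y) / 2 + E₀₀)) ∨
       R = (fun y : ℝ ↦ (∫ u₁ in Set.Ioi (0 : ℝ), ∫ u₂ in Set.Ioi (y / u₁),
              Real.exp (-(u₁ + u₂)) / (1 - Real.exp (-(u₁ + u₂))) ^ 2 * Real.log u₂) -
            (-(Real.log (1 / y) ^ 2) / 8 + E₀₁)) ∨
       R = (fun y : ℝ ↦ (∫ u₁ in Set.Ioi (0 : ℝ), Real.log u₁ * ∫ u₂ in Set.Ioi (y / u₁),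
              Real.exp (-(u₁ + u₂)) / (1 - Real.exp (-(u₁ + u₂))) ^ 2) -
            (-(Real.log (1 / y) ^ 2) / 8 + E₁₀)) ∨
       R = (fun y : ℝ ↦ (∫ u₁ in Set.Ioi (0 : ℝ), ∫ u₂ in Set.Ioi (y / u₁),
              Real.exp (-(u₁ + u₂)) / (1 - Real.exp (-(u₁ + u₂))) ^ 2 * Real.log u₂ ^ 2) -
            (Real.log (1 / y) ^ 3 / 24 + 2 * (∫ v in Set.Ioc (0 : ℝ) 1, Real.log v ^ 2 * (v / (1 + v ^ 2) ^ 2)) * Real.log (1 / y) + E₀₂)) ∨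
       R = (fun y : ℝ ↦ (∫ u₁ in Set.Ioi (0 : ℝ), Real.log u₁ ^ 2 * ∫ u₂ in Set.Ioi (y / u₁),
              Real.exp (-(u₁ + u₂)) / (1 - Real.exp (-(u₁ + u₂))) ^ 2) -
            (Real.log (1 / y) ^ 3 / 24 + 2 * (∫ v in Set.Ioc (0 : ℝ) 1, Real.log v ^ 2 * (v / (1 + v ^ 2) ^ 2)) * Real.log (1 / y) + E₂₀)) ∨
       R = (fun y : ℝ ↦ (∫ u₁ in Set.Ioi (0 : ℝ), Real.log u₁ * ∫ u₂ in Set.Ioi (y / u₁),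
              Real.exp (-(u₁ + u₂)) / (1 - Real.exp (-(u₁ + u₂))) ^ 2 * Real.log u₂) -
            (Real.log (1 / y) ^ 3 / 24 - 2 * (∫ v in Set.Ioc (0 : ℝ) 1, Real.log v ^ 2 * (v / (1 + v ^ 2) ^ 2)) * Real.log (1 / y) + E₁₁)) ∨
       R = (fun y : ℝ ↦ (∫ u₁ in Set.Ioi (0 : ℝ), Real.log u₁ * ∫ u₂ in Set.Ioi (y / u₁),
              Real.exp (-(u₁ + u₂)) / (1 - Real.exp (-(u₁ + u₂))) ^ 2 * Real.log u₂ ^ 2) -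
            (-(Real.log (1 / y) ^ 4) / 64 + (∫ v in Set.Ioc (0 : ℝ) 1, Real.log v ^ 2 * (v / (1 + v ^ 2) ^ 2)) * Real.log (1 / y) ^ 2 / 2 + E₁₂)) ∨
       R = (fun y : ℝ ↦ (∫ u₁ in Set.Ioi (0 : ℝ), Real.log u₁ ^ 2 * ∫ u₂ in Set.Ioi (y / u₁),
              Real.exp (-(u₁ + u₂)) / (1 - Real.exp (-(u₁ + u₂))) ^ 2 * Real.log u₂) -
            (-(Real.log (1 / y) ^ 4) / 64 + (∫ v in Set.Ioc (0 : ℝ) 1, Real.log v ^ 2 * (v / (1 + v ^ 2) ^ 2)) * Real.log (1 / y) ^ 2 / 2 + E₂₁)) ∨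
       R = (fun y : ℝ ↦ (∫ u₁ in Set.Ioi (0 : ℝ), Real.log u₁ ^ 2 * ∫ u₂ in Set.Ioi (y / u₁),
              Real.exp (-(u₁ + u₂)) / (1 - Real.exp (-(u₁ + u₂))) ^ 2 * Real.log u₂ ^ 2) -
            (Real.log (1 / y) ^ 5 / 160 - (∫ v in Set.Ioc (0 : ℝ) 1, Real.log v ^ 2 * (v / (1 + v ^ 2) ^ 2)) * Real.log (1 / y) ^ 3 / 3 + 2 * (∫ v in Set.Ioc (0 : ℝ) 1, Real.log v ^ 4 * (v / (1 + v ^ 2) ^ 2)) * Real.log (1 / y) + E₂₂))) →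
      ∀ (a₁ a₂ : ℕ → ℝ) (Y α B η : ℝ) (K₁ i j : ℕ), 1 ≤ Y → 0 < α → 1 ≤ i → 1 ≤ j →
        (∀ e : ℕ, e ≤ ⌊Y⌋₊ → |∑ k ∈ Icc 1 e, a₂ k| ≤ B) → (∀ e : ℕ, K₁ ≤ e → |∑ k ∈ Icc 1 e, a₁ k| ≤ η) →
        2 * α * K₁ * Y ≤ 1 →
      |∑ k₁ ∈ Icc 1 ⌊Y⌋₊, ∑ k₂ ∈ Icc 1 ⌊Y⌋₊,
          a₁ k₁ * a₂ k₂ * ellp Y k₁ ^ i * ellp Y k₂ ^ j * R (α * k₁ * k₂)| ≤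
        (∑ k ∈ Icc 1 ⌊Y⌋₊, |a₁ k| * ellp Y k ^ i) * (B * (Real.log Y ^ j * (3 * C₀ * Real.sqrt (2 * α * K₁ * Y)))) +
          (∑ k ∈ Icc 1 ⌊Y⌋₊, |a₂ k| * ellp Y k ^ j) *
            ((2 * η) * (Real.log Y ^ i * (9 * C₀ * (1 + |Real.log (2 * α * Y ^ 2)|) ^ 6)))) ∧
    (∀ n : ℕ, n ≠ 0 → ∀ (Y α : ℝ) (K₁ i j : ℕ), 1 ≤ Y → 0 < α → 1 ≤ i → 1 ≤ j → 2 * α * K₁ * Y ≤ 1 →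
    |∑ k₁ ∈ Icc 1 ⌊Y⌋₊, ∑ k₂ ∈ Icc 1 ⌊Y⌋₊,
        (copTauW n k₁ * ∑ p ∈ k₁.primeFactors, Real.log p ^ 2) * (copTauW n k₂ * ∑ p ∈ k₂.primeFactors, Real.log p ^ 2) *
          ellp Y k₁ ^ i * ellp Y k₂ ^ j * (fun y : ℝ ↦ (∫ u₁ in Set.Ioi (0 : ℝ), ∫ u₂ in Set.Ioi (y / u₁),
              Real.exp (-(u₁ + u₂)) / (1 - Real.exp (-(u₁ + u₂))) ^ 2) -
            (Real.log (1 / y) / 2 + E₀₀)) (α * k₁ * k₂)| ≤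
      Real.log Y ^ (i + j) * (C₀ *
        ((3 * ((1 + Real.log Y) ^ 4 + C_P * divWeight n) * (1 + Real.log Y) ^ 4 +
            3 * (C_P * divWeight n) * ((1 + Real.log Y) ^ 4 + C_P * divWeight n) + (C_P * divWeight n) ^ 2) *
            Real.sqrt (2 * α * K₁ * Y) +
          (18 * (1 + Real.log Y) ^ 4 * (C_P * divWeight n) + 19 * (C_P * divWeight n) ^ 2) *
            (1 + |Real.log (2 * α * Y ^ 2)|) ^ 6 / (1 + Real.log K₁) ^ 12))) := by
  obtain ⟨E₀₀, C₀z, C_P, hC₀z, hC_P, hR00, hBS⟩ := abs_bothsided_primeSq_rem00_le₂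
  obtain ⟨E₀₀', E₀₁, E₀₂, E₁₀, E₁₁, C₀a, hC₀a, hA⟩ := abs_doubleSum_rem_le₂₂a
  obtain ⟨E₁₂, E₂₀, E₂₁, E₂₂, C₀b, hC₀b, hBb⟩ := abs_doubleSum_rem_le₂₂b
  set C₀ : ℝ := max (max C₀z C₀a) C₀b with hC₀def
  have ez : C₀z ≤ C₀ := (le_max_left _ _).trans (le_max_left _ _)
  have ea : C₀a ≤ C₀ := (le_max_right _ _).trans (le_max_left _ _)
  have eb : C₀b ≤ C₀ := le_max_right _ _
  have hC₀ : 0 ≤ C₀ := hC₀z.trans ez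
  refine ⟨E₀₀, E₀₁, E₁₀, E₀₂, E₂₀, E₁₁, E₁₂, E₂₁, E₂₂, C₀, C_P, hC₀, hC_P, ?_, ?_⟩
  · intro R hRR a₁ a₂ Y α B η K₁ i j hY hα hi hj hcol hrow hY₁
    have hLY0 : 0 ≤ Real.log Y := Real.log_nonneg hY
    have hB0 : 0 ≤ B := (abs_nonneg _).trans (hcol 0 (Nat.zero_le _))
    have hη0 : 0 ≤ η := (abs_nonneg _).trans (hrow K₁ le_rfl)
    have hS₁ : 0 ≤ ∑ k ∈ Icc 1 ⌊Y⌋₊, |a₁ k| * ellp Y k ^ i :=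
      Finset.sum_nonneg fun k _ ↦ mul_nonneg (abs_nonneg _) (pow_nonneg (ellp_nonneg Y k) i)
    have hS₂ : 0 ≤ ∑ k ∈ Icc 1 ⌊Y⌋₊, |a₂ k| * ellp Y k ^ j :=
      Finset.sum_nonneg fun k _ ↦ mul_nonneg (abs_nonneg _) (pow_nonneg (ellp_nonneg Y k) j)
    have hLi : 0 ≤ Real.log Y ^ i := pow_nonneg hLY0 i
    have hLj : 0 ≤ Real.log Y ^ j := pow_nonneg hLY0 j
    have hs0 : 0 ≤ Real.sqrt (2 * α * K₁ * Y) := Real.sqrt_nonneg _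
    have hx0 : 0 ≤ 1 + |Real.log (2 * α * Y ^ 2)| := by positivity
    rcases hRR with rfl | rfl | rfl | rfl | rfl | rfl | rfl | rfl | rfl
    · exact twoSeq_envelope_mono hS₁ hS₂ hB0 hη0 hLi hLj hs0 hx0 ez
        (hR00 a₁ a₂ Y α B η K₁ i j hY hα hi hj hcol hrow hY₁)
    · exact twoSeq_envelope_mono hS₁ hS₂ hB0 hη0 hLi hLj hs0 hx0 ea
        (hA a₁ a₂ Y α B η K₁ i j hY hα hi hj hcol hrow hY₁).2.1
    · exact twoSeq_envelope_mono hS₁ hS₂ hB0 hη0 hLi hLj hs0 hx0 ea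
        (hA a₁ a₂ Y α B η K₁ i j hY hα hi hj hcol hrow hY₁).2.2.2.1
    · exact twoSeq_envelope_mono hS₁ hS₂ hB0 hη0 hLi hLj hs0 hx0 ea
        (hA a₁ a₂ Y α B η K₁ i j hY hα hi hj hcol hrow hY₁).2.2.1
    · exact twoSeq_envelope_mono hS₁ hS₂ hB0 hη0 hLi hLj hs0 hx0 eb
        (hBb a₁ a₂ Y α B η K₁ i j hY hα hi hj hcol hrow hY₁).2.1
    · exact twoSeq_envelope_mono hS₁ hS₂ hB0 hη0 hLi hLj hs0 hx0 ea
        (hA a₁ a₂ Y α B η K₁ i j hY hα hi hj hcol hrow hY₁).2.2.2.2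
    · exact twoSeq_envelope_mono hS₁ hS₂ hB0 hη0 hLi hLj hs0 hx0 eb
        (hBb a₁ a₂ Y α B η K₁ i j hY hα hi hj hcol hrow hY₁).1
    · exact twoSeq_envelope_mono hS₁ hS₂ hB0 hη0 hLi hLj hs0 hx0 eb
        (hBb a₁ a₂ Y α B η K₁ i j hY hα hi hj hcol hrow hY₁).2.2.1
    · exact twoSeq_envelope_mono hS₁ hS₂ hB0 hη0 hLi hLj hs0 hx0 eb
        (hBb a₁ a₂ Y α B η K₁ i j hY hα hi hj hcol hrow hY₁).2.2.2
  · intro n hn Y α K₁ i j hY hα hi hj hY₁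
    refine (hBS n hn Y α K₁ i j hY hα hi hj hY₁).trans ?_
    have hLY0 : 0 ≤ Real.log Y := Real.log_nonneg hY
    have hD := divWeight_nonneg n
    have hbr : 0 ≤ (3 * ((1 + Real.log Y) ^ 4 + C_P * divWeight n) * (1 + Real.log Y) ^ 4 +
            3 * (C_P * divWeight n) * ((1 + Real.log Y) ^ 4 + C_P * divWeight n) + (C_P * divWeight n) ^ 2) *
            Real.sqrt (2 * α * K₁ * Y) +
          (18 * (1 + Real.log Y) ^ 4 * (C_P * divWeight n) + 19 * (C_P * divWeight n) ^ 2) *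
            (1 + |Real.log (2 * α * Y ^ 2)|) ^ 6 / (1 + Real.log K₁) ^ 12 := by
      have : 0 ≤ Real.log (K₁ : ℝ) := Real.log_natCast_nonneg K₁
      positivity
    exact mul_le_mul_of_nonneg_left (mul_le_mul_of_nonneg_right ez hbr) (pow_nonneg hLY0 _)

/-- **The closing real inequality of the inner estimate of (R₂₂)**: the four envelopes (with their prefactors `81Λ⁴`, `11Λ²`,
`1`, `1`) are `≤ KKs·D²Λ¹²·s + KKt·D²Λ¹²/K12` (`1 ≤ D`, `1 ≤ Λ`, `0 ≤ ly ≤ Λ`, `0 ≤ x ≤ 2Λ`, `s ≥ 0`, `K12 > 0`). [folklore] -/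
theorem envelope_arith₂₂ {D Lam ly x s K12 C₀ C₀z C₁ C₂ C_P : ℝ} (hD1 : 1 ≤ D) (hLam1 : 1 ≤ Lam) (hly0 : 0 ≤ ly)
    (h1LY : ly ≤ Lam) (hx0 : 0 ≤ x) (hxLam : x ≤ 2 * Lam) (hs0 : 0 ≤ s) (hK12 : 0 < K12) (hC₀ : 0 ≤ C₀)
    (hC₀z : 0 ≤ C₀z) (hC₁ : 0 ≤ C₁) (hC₂ : 0 ≤ C₂) (hC_P : 0 ≤ C_P) :
    81 * Lam ^ 4 * (D * (3 * C₀ * C₁ * ly ^ 2 * s + 18 * C₀ * C₂ * ly ^ 2 * x ^ 6 / K12)) +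
        11 * Lam ^ 2 * (3 * C₀ * ly ^ 2 * ly ^ 4 * s + 18 * C₀ * C₂ * D * ly ^ 4 * x ^ 6 / K12) +
        (3 * C₀ * ly ^ 2 * (5 * ly ^ 6) * s + 18 * C₀ * C₂ * D * (5 * ly ^ 6) * x ^ 6 / K12) +
        C₀z * ((3 * (ly ^ 4 + C_P * D) * ly ^ 4 + 3 * (C_P * D) * (ly ^ 4 + C_P * D) + (C_P * D) ^ 2) * s +
          (18 * ly ^ 4 * (C_P * D) + 19 * (C_P * D) ^ 2) * x ^ 6 / K12) ≤
      (C₀ * (243 * C₁ + 33 + 15) + C₀z * (3 + 6 * C_P + 4 * C_P ^ 2)) * (D ^ 2 * (Lam ^ 12 * s)) +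
        (C₀ * (93312 * C₂ + 12672 * C₂ + 5760 * C₂) + C₀z * (1152 * C_P + 1216 * C_P ^ 2)) *
          (D ^ 2 * (Lam ^ 12 / K12)) := by
  have hD0 : 0 ≤ D := zero_le_one.trans hD1
  have hLam0 : 0 ≤ Lam := zero_le_one.trans hLam1
  have hD2 : D ≤ D ^ 2 := le_self_pow₀ hD1 two_ne_zero
  have hD20 : 0 ≤ D ^ 2 := by positivity
  have hD21 : 1 ≤ D ^ 2 := one_le_pow₀ hD1
  have hly2 : ly ^ 2 ≤ Lam ^ 2 := pow_le_pow_left₀ hly0 h1LY 2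
  have hly4 : ly ^ 4 ≤ Lam ^ 4 := pow_le_pow_left₀ hly0 h1LY 4
  have hly6 : ly ^ 6 ≤ Lam ^ 6 := pow_le_pow_left₀ hly0 h1LY 6
  have hly8 : ly ^ 8 ≤ Lam ^ 8 := pow_le_pow_left₀ hly0 h1LY 8
  have hx6 : x ^ 6 ≤ 64 * Lam ^ 6 := by
    calc x ^ 6 ≤ (2 * Lam) ^ 6 := pow_le_pow_left₀ hx0 hxLam 6
      _ = 64 * Lam ^ 6 := by ring
  have hL2 : Lam ^ 2 ≤ Lam ^ 12 := pow_le_pow_right₀ hLam1 (by norm_num)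
  have hL4 : Lam ^ 4 ≤ Lam ^ 12 := pow_le_pow_right₀ hLam1 (by norm_num)
  have hL6 : Lam ^ 6 ≤ Lam ^ 12 := pow_le_pow_right₀ hLam1 (by norm_num)
  have hL8 : Lam ^ 8 ≤ Lam ^ 12 := pow_le_pow_right₀ hLam1 (by norm_num)
  have hL10 : Lam ^ 10 ≤ Lam ^ 12 := pow_le_pow_right₀ hLam1 (by norm_num)
  have hL12 : (0 : ℝ) ≤ Lam ^ 12 := by positivity
  have hL0' : 1 ≤ Lam ^ 12 := one_le_pow₀ hLam1
  -- elementary monomial inequalities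
  have q1 : D * ly ^ 2 * Lam ^ 4 * s ≤ D ^ 2 * (Lam ^ 12 * s) := by
    have : ly ^ 2 * Lam ^ 4 ≤ Lam ^ 12 :=
      (mul_le_mul_of_nonneg_right hly2 (by positivity)).trans (by rw [← pow_add]; exact hL6)
    calc D * ly ^ 2 * Lam ^ 4 * s = D * (ly ^ 2 * Lam ^ 4) * s := by ring
      _ ≤ D ^ 2 * Lam ^ 12 * s := by gcongr
      _ = _ := by ring
  have q2 : D * ly ^ 2 * x ^ 6 * Lam ^ 4 / K12 ≤ 64 * (D ^ 2 * (Lam ^ 12 / K12)) := by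
    have : ly ^ 2 * x ^ 6 * Lam ^ 4 ≤ 64 * Lam ^ 12 := by
      calc ly ^ 2 * x ^ 6 * Lam ^ 4 ≤ Lam ^ 2 * (64 * Lam ^ 6) * Lam ^ 4 := by gcongr
        _ = 64 * Lam ^ 12 := by ring
    calc D * ly ^ 2 * x ^ 6 * Lam ^ 4 / K12 = D * (ly ^ 2 * x ^ 6 * Lam ^ 4) / K12 := by ring
      _ ≤ D ^ 2 * (64 * Lam ^ 12) / K12 := by gcongr
      _ = _ := by ring
  have q3 : ly ^ 2 * ly ^ 4 * Lam ^ 2 * s ≤ D ^ 2 * (Lam ^ 12 * s) := by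
    have : ly ^ 2 * ly ^ 4 * Lam ^ 2 ≤ Lam ^ 12 := by
      calc ly ^ 2 * ly ^ 4 * Lam ^ 2 ≤ Lam ^ 2 * Lam ^ 4 * Lam ^ 2 := by gcongr
        _ = Lam ^ 8 := by ring
        _ ≤ Lam ^ 12 := hL8
    calc ly ^ 2 * ly ^ 4 * Lam ^ 2 * s ≤ Lam ^ 12 * s := mul_le_mul_of_nonneg_right this hs0
      _ = 1 * (Lam ^ 12 * s) := by ring
      _ ≤ D ^ 2 * (Lam ^ 12 * s) := by gcongr
  have q4 : D * ly ^ 4 * x ^ 6 * Lam ^ 2 / K12 ≤ 64 * (D ^ 2 * (Lam ^ 12 / K12)) := by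
    have : ly ^ 4 * x ^ 6 * Lam ^ 2 ≤ 64 * Lam ^ 12 := by
      calc ly ^ 4 * x ^ 6 * Lam ^ 2 ≤ Lam ^ 4 * (64 * Lam ^ 6) * Lam ^ 2 := by gcongr
        _ = 64 * Lam ^ 12 := by ring
    calc D * ly ^ 4 * x ^ 6 * Lam ^ 2 / K12 = D * (ly ^ 4 * x ^ 6 * Lam ^ 2) / K12 := by ring
      _ ≤ D ^ 2 * (64 * Lam ^ 12) / K12 := by gcongr
      _ = _ := by ring
  have q5 : ly ^ 2 * ly ^ 6 * s ≤ D ^ 2 * (Lam ^ 12 * s) := by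
    have : ly ^ 2 * ly ^ 6 ≤ Lam ^ 12 := by
      calc ly ^ 2 * ly ^ 6 ≤ Lam ^ 2 * Lam ^ 6 := by gcongr
        _ = Lam ^ 8 := by ring
        _ ≤ Lam ^ 12 := hL8
    calc ly ^ 2 * ly ^ 6 * s ≤ Lam ^ 12 * s := mul_le_mul_of_nonneg_right this hs0
      _ = 1 * (Lam ^ 12 * s) := by ring
      _ ≤ D ^ 2 * (Lam ^ 12 * s) := by gcongr
  have q6 : D * ly ^ 6 * x ^ 6 / K12 ≤ 64 * (D ^ 2 * (Lam ^ 12 / K12)) := by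
    have : ly ^ 6 * x ^ 6 ≤ 64 * Lam ^ 12 := by
      calc ly ^ 6 * x ^ 6 ≤ Lam ^ 6 * (64 * Lam ^ 6) := by gcongr
        _ = 64 * Lam ^ 12 := by ring
    calc D * ly ^ 6 * x ^ 6 / K12 = D * (ly ^ 6 * x ^ 6) / K12 := by ring
      _ ≤ D ^ 2 * (64 * Lam ^ 12) / K12 := by gcongr
      _ = _ := by ring
  have q7 : ly ^ 8 * s ≤ D ^ 2 * (Lam ^ 12 * s) := by
    calc ly ^ 8 * s ≤ Lam ^ 12 * s := mul_le_mul_of_nonneg_right (hly8.trans hL8) hs0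
      _ = 1 * (Lam ^ 12 * s) := by ring
      _ ≤ D ^ 2 * (Lam ^ 12 * s) := by gcongr
  have q8 : D * ly ^ 4 * s ≤ D ^ 2 * (Lam ^ 12 * s) := by
    calc D * ly ^ 4 * s ≤ D ^ 2 * Lam ^ 12 * s := by gcongr; exact hly4.trans hL4
      _ = _ := by ring
  have q9 : D ^ 2 * s ≤ D ^ 2 * (Lam ^ 12 * s) := by
    calc D ^ 2 * s = D ^ 2 * (1 * s) := by ring
      _ ≤ D ^ 2 * (Lam ^ 12 * s) := by gcongr
  have q10 : D * ly ^ 4 * x ^ 6 / K12 ≤ 64 * (D ^ 2 * (Lam ^ 12 / K12)) := by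
    have : ly ^ 4 * x ^ 6 ≤ 64 * Lam ^ 12 := by
      calc ly ^ 4 * x ^ 6 ≤ Lam ^ 4 * (64 * Lam ^ 6) := by gcongr
        _ = 64 * Lam ^ 10 := by ring
        _ ≤ 64 * Lam ^ 12 := by gcongr
    calc D * ly ^ 4 * x ^ 6 / K12 = D * (ly ^ 4 * x ^ 6) / K12 := by ring
      _ ≤ D ^ 2 * (64 * Lam ^ 12) / K12 := by gcongr
      _ = _ := by ring
  have q11 : D ^ 2 * x ^ 6 / K12 ≤ 64 * (D ^ 2 * (Lam ^ 12 / K12)) := by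
    calc D ^ 2 * x ^ 6 / K12 ≤ D ^ 2 * (64 * Lam ^ 6) / K12 := by gcongr
      _ ≤ D ^ 2 * (64 * Lam ^ 12) / K12 := by gcongr
      _ = _ := by ring
  -- with their constants
  have r1 := mul_le_mul_of_nonneg_left q1 (show 0 ≤ C₀ * C₁ by positivity)
  have r2 := mul_le_mul_of_nonneg_left q2 (show 0 ≤ C₀ * C₂ by positivity)
  have r3 := mul_le_mul_of_nonneg_left q3 hC₀
  have r4 := mul_le_mul_of_nonneg_left q4 (show 0 ≤ C₀ * C₂ by positivity)
  have r5 := mul_le_mul_of_nonneg_left q5 hC₀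
  have r6 := mul_le_mul_of_nonneg_left q6 (show 0 ≤ C₀ * C₂ by positivity)
  have r7 := mul_le_mul_of_nonneg_left q7 hC₀z
  have r8 := mul_le_mul_of_nonneg_left q8 (show 0 ≤ C₀z * C_P by positivity)
  have r9 := mul_le_mul_of_nonneg_left q9 (show 0 ≤ C₀z * C_P ^ 2 by positivity)
  have r10 := mul_le_mul_of_nonneg_left q10 (show 0 ≤ C₀z * C_P by positivity)
  have r11 := mul_le_mul_of_nonneg_left q11 (show 0 ≤ C₀z * C_P ^ 2 by positivity)
  simp only [div_eq_mul_inv] at r2 r4 r6 r10 r11 ⊢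
  linarith only [r1, r2, r3, r4, r5, r6, r7, r8, r9, r10, r11]

end Summit.Parity.GeneralizedHardyLittlewood.Theorems.MomentsBeyondDiagonal.DiagCorner

end
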